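import Mathlib
import Summits.ResolutionOfSingularities.ResolutionOfSingularities.Theorems.WeightedInvariantLocalWeightedDropWildMonicFlagBound

/-!
# `WeightedInvariant.LocalWeightedDrop`, line `hasse-ridge-face-selection`, S3ρ sub-stub S3ρD: item D-0 «a maximising flag exists» —
# hbounds (ii) for `IsFlagTriple d`, VALID FLAGS EXIST in every class, and D-0 from the three remaining pieces

Crux item stmt-ResolutionOfSingularities-8899 `LocalWeightedDrop` (route `ResolutionOfSingularities/WeightedInvariant`), engine of the
door `HypersurfaceCentreConstruction` stmt-ResolutionOfSingularities-19897.  [OURS · L1 W4.3, chain w43, res-L1-w43-stub-1 (gen 4) =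
second hand on roadmap item D-0 of `L/res-L1-w43-stub-7/S3RHOD-ROADMAP.md` under the S3ρ owners res-type-083 / stub-7 and the D-0
holder res-L1-w43-stub-3 (plan-1 RULINGS gen 9 #3 (R2), CHAIN v4.10); consumer `WildMonic.attainShape_of_bounds_of_attain`
(`…WildMonicFlagAttainShape`, p511775); the uniform bound is `…WildMonicFlagBound` (`exists_deltaL_flagTuple_le`).  MODEL:
S. Perlega, thesis Wien 2017 / arXiv:2011.14443 §7.2.3 (valid flags), §7.4.1 Lemma 7.4.1, §7.4.3 Prop. 7.4.10 / Lemma 7.4.11.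
Nothing here is a statement of H. Hironaka's manuscript; every object is OURS.]

* **`exists_forall_isFlagTriple_fst_le`** — hbounds (ii) of `attainShape_of_bounds_of_attain` for `Φ := IsFlagTriple d`: the
  `d`-components of ALL flag triples of a non-exit position are bounded (by `δ` of the `ord`-clean re-centring; no kangaroo — any bound
  suffices for the existence of a maximising flag, the sharp `d*` of Per17 Prop. 7.4.8 (1) is a matter for the drop).
* **`exists_isMMax`** — VALID FLAGS EXIST IN EVERY CLASS `(o, h)`: `m` is bounded over the re-centrings `g` (by `δ + n(δ + d!)`), hence
  attained (Per17 §7.2.3); `exists_isFlagTriple` — the flag triples of a non-exit position are inhabited.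
* `thd_eq_zero_of_isFlagTriple_of_snd_ne_zero` — tangent classes (`n ≥ 1`) carry `s = 0`, so the classwise `s`-attainment (D-0d) is
  owed for the `n = 0` classes only; **`attainShape_isFlagTriple_of_pieces`** — `AttainShape (IsFlagTriple d) p` from the THREE
  remaining pieces HPOS (a flag triple with `d > 0`; Per17 Lemma 7.4.4 (1) / 7.4.11), HN (`n ≥ N ⇒ d = 0`; Prop. 7.4.8 (2)) and HS₀
  (finite greatest `s` in every inhabited `n = 0` class with `d = D > 0`; Props. 7.4.5 (3) / 7.4.6 with Prop. 5.3.5).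
AI-written; gate-accepted means sorry-free with standard axioms, not refereed.
-/

set_option linter.dupNamespace false -- mandated namespace of this single-conjunct summit

noncomputable section

namespace Summit.ResolutionOfSingularities.ResolutionOfSingularities.Theorems

namespace WildMonic

open MvPowerSeries MonicDescent
open Literature.AlgebraicGeometry.Resolution
open Literature.AlgebraicGeometry.Resolution.HauserPerlega2024 (Triple)
open PurePowerFlag (swap swapE orient orientE IsN0 IsTangent)

variable {k : Type} [Field k] {d : ℕ}

/-! ### Consequences of the uniform bound for the flag family -/

section Bound

variable (p : ℕ) [Fact p.Prime] [CharP k p] [PerfectRing k p]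


/-- **hbounds (ii) OF `attainShape_of_bounds_of_attain` FOR `Φ := IsFlagTriple d`**: the `d`-components of all flag triples of a
non-exit position are bounded (no kangaroo needed for a mere bound). [cite: Perlega2020, Lemma 7.4.1, Prop. 7.4.10
(arXiv:2011.14443 chunks p0092, p0094)] -/
theorem exists_forall_isFlagTriple_fst_le (hd : 0 < d) {A : Fin d → MvPowerSeries (Fin 2) k} (hA : IsPos d A)
    (hex : ¬ Exit₃ p d A) (E : Finset (Fin 2)) :
    ∃ M : ℕ, ∀ v, IsFlagTriple d A E v → (ofLex v).1 ≤ M := by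
  obtain ⟨M, hM⟩ := exists_deltaL_flagTuple_le p hd hA hex
  refine ⟨M, ?_⟩
  rintro v ⟨o, g, h, hg, hh, hadm, -, rfl⟩
  exact (flagTriple_fst_le_deltaL hh hadm).trans (hM o g h hg hh)

/-- **VALID FLAGS EXIST IN EVERY CLASS** (Per17 §7.2.3): for every orientation `o` and shear `h(0) = 0` some re-centring `g(0) = 0`
maximises `m` over all re-centrings — `m` is bounded over the class, hence attained. [cite: Perlega2020, §7.2.3 «valid flags»,
Lemma 7.4.1 (arXiv:2011.14443 chunks p0088 L154–L165, p0092)] -/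
theorem exists_isMMax (hd : 0 < d) {A : Fin d → MvPowerSeries (Fin 2) k} (hA : IsPos d A) (hex : ¬ Exit₃ p d A)
    (E : Finset (Fin 2)) (o : Bool) {h : PowerSeries k} (hh : PowerSeries.constantCoeff h = 0) :
    ∃ g : MvPowerSeries (Fin 2) k, constantCoeff g = 0 ∧ IsMMax d (orientT o A) (orientE o E) g h := by
  classical
  obtain ⟨M, hM⟩ := exists_deltaL_flagTuple_le p hd hA hex
  let S : Set ℕ := {m | ∃ g : MvPowerSeries (Fin 2) k, constantCoeff g = 0 ∧ mOf d (orientT o A) (orientE o E) g h = m}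
  have hS0 : mOf d (orientT o A) (orientE o E) 0 h ∈ S := ⟨0, map_zero _, rfl⟩
  have hbdd : BddAbove S := by
    refine ⟨M + PurePowerFlag.tangency h * (M + d.factorial), ?_⟩
    rintro m ⟨g, hg, rfl⟩
    have hδ := hM o g h hg hh
    calc mOf d (orientT o A) (orientE o E) g h
        ≤ deltaL (newtonSet (flagTuple d (orientT o A) g h)) +
            PurePowerFlag.tangency h * (deltaL (newtonSet (flagTuple d (orientT o A) g h)) + d.factorial) :=
          mOf_le _ _ _ hh
      _ ≤ M + PurePowerFlag.tangency h * (M + d.factorial) := by gcongr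
  obtain ⟨g, hg, hgm⟩ : sSup S ∈ S := Nat.sSup_mem ⟨_, hS0⟩ hbdd
  refine ⟨g, hg, fun g' hg' => ?_⟩
  rw [hgm]
  exact le_csSup hbdd ⟨g', hg', rfl⟩

/-- The set of flag triples of a non-exit position is INHABITED (the coordinate class `o = false`, `h = 0` has a valid flag). -/
theorem exists_isFlagTriple (hd : 0 < d) {A : Fin d → MvPowerSeries (Fin 2) k} (hA : IsPos d A) (hex : ¬ Exit₃ p d A)
    (E : Finset (Fin 2)) : ∃ v, IsFlagTriple d A E v := by
  obtain ⟨g, hg, hmax⟩ := exists_isMMax p hd hA hex E false (h := 0) (map_zero _)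
  rw [orientT_false, PurePowerFlag.orientE_false] at hmax
  exact ⟨_, isFlagTriple_of_first hg (map_zero _) (Or.inl (Or.inr rfl)) hmax⟩

end Bound

/-! ### Tangent classes carry `s = 0`: the classwise `s`-attainment is owed for `n = 0` classes only -/

/-- The `n`-component of the triple of an admissible flag vanishes iff the flag is an `n = 0` flag. -/
theorem flagTriple_snd_fst_eq_zero_iff {A : Fin d → MvPowerSeries (Fin 2) k} {E : Finset (Fin 2)} {g : MvPowerSeries (Fin 2) k}
    {h : PowerSeries k} (hh : PowerSeries.constantCoeff h = 0) (hadm : IsN0 E h ∨ IsTangent E h) :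
    (ofLex (ofLex (flagTriple d A E g h)).2).1 = 0 ↔ IsN0 E h := by
  rw [flagTriple_snd_fst]
  constructor
  · intro h0
    by_contra hn
    rw [if_neg hn] at h0
    rcases hadm with hN | hT
    · exact hn hN
    · have := PurePowerFlag.one_le_tangency hh hT.2.1
      omega
  · intro hN
    rw [if_pos hN]

/-- A flag triple with `n ≠ 0` has `s = 0`. -/
theorem thd_eq_zero_of_isFlagTriple_of_snd_ne_zero {A : Fin d → MvPowerSeries (Fin 2) k} {E : Finset (Fin 2)} {v : Triple}
    (hv : IsFlagTriple d A E v) (hn : (ofLex (ofLex v).2).1 ≠ 0) : (ofLex (ofLex v).2).2 = 0 := by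
  obtain ⟨o, g, h, -, -, -, -, rfl⟩ := hv
  by_cases hN : IsN0 (orientE o E) h
  · exact absurd (by rw [flagTriple_snd_fst, if_pos hN]) hn
  · exact flagTriple_snd_snd_of_not_isN0 hN

/-- **D-0 FOR `IsFlagTriple d` FROM THE THREE REMAINING PIECES**: HPOS (a flag triple with `d > 0`), HN (`n ≥ N ⇒ d = 0`) and HS₀
(every inhabited class of `n = 0` triples with fixed `d = D > 0` has a member with finite `s` dominating the class) — hbounds (ii) being
`exists_forall_isFlagTriple_fst_le` and the tangent classes being trivial. [cite: Perlega2020, Prop. 7.4.10, Lemma 7.4.11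
(arXiv:2011.14443 §7.4.3, chunk p0094 L60–L67)] -/
theorem attainShape_isFlagTriple_of_pieces (p : ℕ) [Fact p.Prime] [CharP k p] [PerfectRing k p] (hd : 0 < d)
    (hpos : ∀ (A : Fin d → MvPowerSeries (Fin 2) k) (E : Finset (Fin 2)), IsPos d A → ¬ Exit₃ p d A →
      ∃ v, IsFlagTriple d A E v ∧ 0 < (ofLex v).1)
    (hN : ∀ (A : Fin d → MvPowerSeries (Fin 2) k) (E : Finset (Fin 2)), IsPos d A → ¬ Exit₃ p d A →
      ∃ N : ℕ, ∀ v, IsFlagTriple d A E v → N ≤ (ofLex (ofLex v).2).1 → (ofLex v).1 = 0)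
    (hs₀ : ∀ (A : Fin d → MvPowerSeries (Fin 2) k) (E : Finset (Fin 2)), IsPos d A → ¬ Exit₃ p d A →
      ∀ D : ℕ, 0 < D → (∃ v, IsFlagTriple d A E v ∧ (ofLex v).1 = D ∧ (ofLex (ofLex v).2).1 = 0) →
        ∃ v, IsFlagTriple d A E v ∧ (ofLex v).1 = D ∧ (ofLex (ofLex v).2).1 = 0 ∧ (ofLex (ofLex v).2).2 ≠ ⊤ ∧
          ∀ w, IsFlagTriple d A E w → (ofLex w).1 = D → (ofLex (ofLex w).2).1 = 0 →
            (ofLex (ofLex w).2).2 ≤ (ofLex (ofLex v).2).2) :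
    AttainShape (k := k) (IsFlagTriple d) p := by
  refine attainShape_of_bounds_of_attain (IsFlagTriple d) p
    (fun A E hA hex => ⟨hpos A E hA hex, exists_forall_isFlagTriple_fst_le p hd hA hex E, hN A E hA hex⟩) ?_
  rintro A E hA hex D n hD ⟨u, hu, huD, hun⟩
  by_cases hn0 : n = 0
  · subst hn0
    exact hs₀ A E hA hex D hD ⟨u, hu, huD, hun⟩
  · -- a class of tangent flags: `s = 0` throughout
    have hus : (ofLex (ofLex u).2).2 = 0 := thd_eq_zero_of_isFlagTriple_of_snd_ne_zero hu (by rw [hun]; exact hn0)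
    refine ⟨u, hu, huD, hun, by rw [hus]; exact ENat.zero_ne_top, fun w hw _ hwn => ?_⟩
    have hws : (ofLex (ofLex w).2).2 = 0 := thd_eq_zero_of_isFlagTriple_of_snd_ne_zero hw (by rw [hwn]; exact hn0)
    rw [hus, hws]

end WildMonic

end Summit.ResolutionOfSingularities.ResolutionOfSingularities.Theorems

end
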